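import Mathlib
import Literature.Computability.MetaComplexity.FpLinearSystems
import Literature.Computability.MetaComplexity.ScopeExpansion
import HarnessLib
import Summits.PneNP.PneNP.Theses.ExpanderLinearGenerators
import Summits.PneNP.PneNP.Theorems.ExpanderLinearGeneratorsFreeCayleySystem
import Summits.PneNP.PneNP.Theorems.ExpanderLinearGeneratorsLinearGeneratorModPFregeHardCalibration

/-!
# PneNP / ExpanderLinearGenerators — `LinearGeneratorDepthFregeHard` is NOT vacuous: explicit
expanding unsolvable `16`-sparse systems for every large `n` (stmt-PneNP-11443, helper file 4)

Route `PneNP/ExpanderLinearGenerators`, support item stmt-PneNP-11443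
(`Summit.PneNP.PneNP.Theses.ExpanderLinearGenerators.LinearGeneratorDepthFregeHard`, Krajíček's
Problem 19.4.5 in universal-expander form: for every locality `ℓ ≥ 1`, depth `d` and
`0 < δ < 1`, every `ℓ`-sparse unsolvable system over `𝔽₂` on `n ≫ 0` variables whose row
supports form an `(n^(1-δ), 3ℓ/4)`-boundary expander has only depth-`d` `textbookFrege`
refutations of size `≥ 2^(n^ε)`).

The localities `ℓ ≤ 8` of the item admit NO such system
(`…LinearGeneratorDepthFregeHardLocalityFloor/Eight`), which raised the question whether the
item has content at all. This file answers it: **for `ℓ = 16` and every `δ ∈ [199/200, 1)` the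
hypotheses are satisfiable for EVERY `n ≥ 2¹¹ · 800⁸`, and the refuted formula has depth-`d`
`textbookFrege` proofs for every `d ≥ 30`** — so on the slice `ℓ = 16, d ≥ 30, δ ≥ 199/200` the
item is a genuine (and, beyond column weight `2` methods, open) exponential lower bound for
bounded-depth Frege on explicit Tseitin formulas, not an implication with empty antecedent.

The systems (`sysOf n`) are the Tseitin systems of the Cayley graphs of `SL₂(ℤ/N)`,
`N = 2 · 800^(2R) + 1`, `R = ⌊log_{800⁸}(n / 2¹¹)⌋`, with respect to the eight free generators
`BᵏAB⁻ᵏ` (`k < 8`; Margulis 1982): helper files `…FreeCayleyPingPong` (no reduced relation of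
length `≤ 2R`), `…FreeCayleyLocal` (sets of `≤ 2^R` vertices span `≤ 2` edges per vertex),
`…FreeCayleySystem` (`16`-sparse, unsolvable, `(r, 12)`-boundary expanding for `r ≤ 2^R`); here
only the parameter bookkeeping `8|SL₂(ℤ/N)| ≤ n ≤ 2^(200R)` (so `n^(1/200) ≤ 2^R`) remains.

* `exists_expanding_unsat_system` — for `n ≥ 2¹¹ · 800⁸`: a `16`-sparse system on `n` variables,
  `(n^(1 - 199/200), 3/4 · 16)`-boundary expanding and unsolvable;
  `exists_expanding_unsat_system_radius` — for every real `r` an unsolvable `16`-sparse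
  `(r, 3/4 · 16)`-boundary expander (non-vacuity of the sibling item stmt-PneNP-11442 at `ℓ = 16`);
* **`linearGeneratorDepthFregeHard_hypotheses_nonvacuous`** — the same for every
  `δ ≥ 199/200`, together with depth-`d` proofs of the refuted formula for every `d ≥ 30`;
* `linearGeneratorDepthFregeHard_witnessed` — hence, IF the item holds, its bound `2^(n^ε)` is
  attained by actual proofs: for `d ≥ 30`, `199/200 ≤ δ < 1` there are `ε > 0` and, for all large
  `n`, systems and depth-`d` refutations of size `≥ 2^(n^ε)`.

References: G. A. Margulis, *Explicit constructions of graphs without short cycles and low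
density codes*, Combinatorica 2 (1982) 71–78 [Margulis1982]; J. Krajíček, *Proof Complexity*
(CUP 2019), Problem 19.4.5 [KrajicekProofComplexity2019].
-/

namespace Summit.PneNP.PneNP.Theorems

set_option linter.dupNamespace false -- `Summit.PneNP.PneNP.…`: summit = sub-problem (D-0017)

open Finset Literature.Computability.MetaComplexity Literature.Computability.Complexity

namespace FreeCayley

/-! ### The groups `SL₂(ℤ/N)` with the Margulis generators -/

/-- `SL₂(ℤ/N)` has at most `N⁴` elements. [folklore] -/
theorem card_specialLinearGroup_le (N : ℕ) [NeZero N] :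
    Fintype.card (Matrix.SpecialLinearGroup (Fin 2) (ZMod N)) ≤ N ^ 4 := by
  refine (Fintype.card_subtype_le _).trans ?_
  change Fintype.card (Fin 2 → Fin 2 → ZMod N) ≤ _
  rw [Fintype.card_fun, Fintype.card_fun, ZMod.card, Fintype.card_fin, ← pow_mul]

/-- **No short relations among the Margulis generators of `SL₂(ℤ/N)`** (`N > 2 · 800^L`).
[cite: Margulis1982, main construction] -/
theorem noShortRelations_gen {N L : ℕ} (h : 2 * 800 ^ L < N) : NoShortRelations (gen N) L :=
  fun _w hw hne hlen => wordVal_ne_one h hw hne hlen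

/-! ### Parameters -/

/-- The depth parameter `R(n) = ⌊log_{800⁸}(n / 2¹¹)⌋`. [folklore] -/
def rOf (n : ℕ) : ℕ := Nat.log (800 ^ 8) (n / 2 ^ 11)

/-- The modulus `N(n) = 2 · 800^(2R) + 1`. [folklore] -/
def nOf (n : ℕ) : ℕ := 2 * 800 ^ (2 * rOf n) + 1

/-- The modulus is nonzero. [folklore] -/
instance neZero_nOf (n : ℕ) : NeZero (nOf n) := ⟨by unfold nOf; omega⟩

/-- The group `SL₂(ℤ/N(n))`. [folklore] -/
abbrev Gp (n : ℕ) : Type := Matrix.SpecialLinearGroup (Fin 2) (ZMod (nOf n))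

/-- The number of equations `m(n) = |SL₂(ℤ/N(n))|`. [folklore] -/
noncomputable def mOf (n : ℕ) : ℕ := Fintype.card (Gp n)

/-- **The witness systems**: the Tseitin system of the Cayley graph of `SL₂(ℤ/N(n))` with
respect to the Margulis generators, on `n` variables. [cite: Margulis1982, main construction] -/
noncomputable def sysOf (n : ℕ) : Fin (mOf n) → LinEqMod 2 n := tseitin (gen (nOf n)) n

/-- The threshold `n ≥ 2¹¹ · 800⁸` gives `R ≥ 1`. [folklore] -/
theorem one_le_rOf {n : ℕ} (hn : 2 ^ 11 * 800 ^ 8 ≤ n) : 1 ≤ rOf n := by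
  unfold rOf
  refine Nat.log_pos (by norm_num) ?_
  exact (Nat.le_div_iff_mul_le (by norm_num)).2 (by linarith)

/-- The variables fit: `8 · m(n) ≤ n`. [folklore] -/
theorem eight_mul_mOf_le {n : ℕ} (hn : 2 ^ 11 * 800 ^ 8 ≤ n) : 8 * mOf n ≤ n := by
  have h1 : mOf n ≤ nOf n ^ 4 := card_specialLinearGroup_le _
  set Q := 800 ^ (2 * rOf n) with hQ
  have hQ1 : 1 ≤ Q := Nat.one_le_pow _ _ (by norm_num)
  have h2 : nOf n ≤ 4 * Q := by unfold nOf; omega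
  have h3 : nOf n ^ 4 ≤ 256 * Q ^ 4 := by
    calc nOf n ^ 4 ≤ (4 * Q) ^ 4 := Nat.pow_le_pow_left h2 4
      _ = 256 * Q ^ 4 := by ring
  have h4 : Q ^ 4 = (800 ^ 8) ^ rOf n := by rw [hQ, ← pow_mul, ← pow_mul]; ring_nf
  have h5 : (800 ^ 8) ^ rOf n ≤ n / 2 ^ 11 := by
    unfold rOf
    exact Nat.pow_log_le_self _ (by
      intro h0
      have := Nat.div_eq_zero_iff.1 h0
      omega)
  have h6 : 2 ^ 11 * (n / 2 ^ 11) ≤ n := Nat.mul_div_le n (2 ^ 11)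
  calc 8 * mOf n ≤ 8 * (256 * Q ^ 4) := by omega
    _ = 2 ^ 11 * (800 ^ 8) ^ rOf n := by rw [h4]; ring
    _ ≤ 2 ^ 11 * (n / 2 ^ 11) := Nat.mul_le_mul_left _ h5
    _ ≤ n := h6

/-- The expansion radius fits: `n ≤ 2^(200 R)`. [folklore] -/
theorem le_two_pow_rOf {n : ℕ} (hn : 2 ^ 11 * 800 ^ 8 ≤ n) : n ≤ 2 ^ (200 * rOf n) := by
  have hR := one_le_rOf hn
  have h1 : n / 2 ^ 11 < (800 ^ 8) ^ (rOf n + 1) := Nat.lt_pow_succ_log_self (by norm_num) _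
  have h2 : n < 2 ^ 11 * (n / 2 ^ 11 + 1) := Nat.lt_mul_div_succ n (by norm_num)
  have h3 : (800 ^ 8) ^ (rOf n + 1) ≤ (2 ^ 80) ^ (rOf n + 1) :=
    Nat.pow_le_pow_left (by norm_num) _
  have h4 : 2 ^ 11 * (2 ^ 80) ^ (rOf n + 1) = 2 ^ (80 * rOf n + 91) := by
    rw [← pow_mul, ← pow_add]; ring_nf
  have h5 : 2 ^ (80 * rOf n + 91) ≤ 2 ^ (200 * rOf n) :=
    Nat.pow_le_pow_right (by norm_num) (by omega)
  have h6 : 2 ^ 11 * (n / 2 ^ 11 + 1) ≤ 2 ^ 11 * (800 ^ 8) ^ (rOf n + 1) :=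
    Nat.mul_le_mul_left _ h1
  have h7 : 2 ^ 11 * (800 ^ 8) ^ (rOf n + 1) ≤ 2 ^ 11 * (2 ^ 80) ^ (rOf n + 1) :=
    Nat.mul_le_mul_left _ h3
  omega

/-- The real-number form: `n^(1 - 199/200) ≤ 2^R`. [folklore] -/
theorem rpow_le_two_pow_rOf {n : ℕ} (hn : 2 ^ 11 * 800 ^ 8 ≤ n) :
    (n : ℝ) ^ (1 - (199 / 200 : ℝ)) ≤ 2 ^ rOf n := by
  have h1 : (n : ℝ) ≤ ((2 : ℝ) ^ rOf n) ^ 200 := by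
    rw [← pow_mul, mul_comm]
    exact_mod_cast le_two_pow_rOf hn
  have h2 : (1 - (199 / 200 : ℝ)) = ((200 : ℕ) : ℝ)⁻¹ := by norm_num
  rw [h2]
  calc (n : ℝ) ^ (((200 : ℕ) : ℝ)⁻¹) ≤ (((2 : ℝ) ^ rOf n) ^ 200) ^ (((200 : ℕ) : ℝ)⁻¹) :=
        Real.rpow_le_rpow (Nat.cast_nonneg n) h1 (by positivity)
    _ = 2 ^ rOf n := Real.pow_rpow_inv_natCast (by positivity) (by norm_num)

/-! ### The witnesses -/

/-- **Properties of the witness systems.** For `n ≥ 2¹¹ · 800⁸` the system `sysOf n` is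
`16`-sparse, unsolvable, and its supports form an `(r, 3/4 · 16)`-boundary expander for every
`r ≤ 2^R(n)`, in particular for `r = n^(1 - 199/200)`. [cite: Margulis1982, main construction] -/
theorem sysOf_spec {n : ℕ} (hn : 2 ^ 11 * 800 ^ 8 ≤ n) :
    (∀ i, (sysOf n i).supp.card ≤ 16) ∧
    (∀ r : ℝ, r ≤ 2 ^ rOf n →
      IsBoundaryExpander (fun i => (sysOf n i).supp.map Fin.valEmbedding) r
        (3 / 4 * ((16 : ℕ) : ℝ))) ∧
    ¬ SystemSat (sysOf n) Finset.univ := by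
  have hR := one_le_rOf hn
  have hm := eight_mul_mOf_le hn
  have hL : NoShortRelations (gen (nOf n)) (2 * rOf n) :=
    noShortRelations_gen (by unfold nOf; omega)
  have hg : ∀ σ : Letter, gen (nOf n) σ.bar = (gen (nOf n) σ)⁻¹ := gen_bar (nOf n)
  refine ⟨fun i => card_supp_tseitin_le _ hm i, fun r hr => ?_,
    not_systemSat_tseitin _ (hL.g_ne_one (by omega))⟩
  have h12 : (3 / 4 * ((16 : ℕ) : ℝ)) = 12 := by norm_num
  rw [h12]
  exact isBoundaryExpander_tseitin _ hg hR hL hm hr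

/-- **Expanding unsolvable `16`-sparse systems exist on `n` variables for every
`n ≥ 2¹¹ · 800⁸`**, at expansion radius `n^(1 - 199/200)` and ratio `3/4 · 16`.
[cite: Margulis1982, main construction] -/
theorem exists_expanding_unsat_system {n : ℕ} (hn : 2 ^ 11 * 800 ^ 8 ≤ n) :
    ∃ (m : ℕ) (E : Fin m → LinEqMod 2 n), (∀ i, (E i).supp.card ≤ 16) ∧
      IsBoundaryExpander (fun i => (E i).supp.map Fin.valEmbedding)
        ((n : ℝ) ^ (1 - (199 / 200 : ℝ))) (3 / 4 * ((16 : ℕ) : ℝ)) ∧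
      ¬ SystemSat E Finset.univ := by
  obtain ⟨h1, h2, h3⟩ := sysOf_spec hn
  exact ⟨mOf n, sysOf n, h1, h2 _ (rpow_le_two_pow_rOf hn), h3⟩

/-- `R(2¹¹ · (800⁸)^R) = R`. [folklore] -/
theorem rOf_threshold (R : ℕ) : rOf (2 ^ 11 * (800 ^ 8) ^ R) = R := by
  unfold rOf
  rw [Nat.mul_div_cancel_left _ (by norm_num)]
  exact Nat.log_pow (by norm_num) R

/-- **Every expansion radius is realised** (non-vacuity of the sibling item stmt-PneNP-11442,
`ExpansionForcesDepthFregeSize`, at `ℓ = 16`): for every real `r` there is an unsolvable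
`16`-sparse system over `𝔽₂` whose supports form an `(r, 3/4 · 16)`-boundary expander.
[cite: Margulis1982, main construction] -/
theorem exists_expanding_unsat_system_radius (r : ℝ) :
    ∃ (n m : ℕ) (E : Fin m → LinEqMod 2 n), (∀ i, (E i).supp.card ≤ 16) ∧
      IsBoundaryExpander (fun i => (E i).supp.map Fin.valEmbedding) r (3 / 4 * ((16 : ℕ) : ℝ)) ∧
      ¬ SystemSat E Finset.univ := by
  -- a radius exponent `R ≥ 1` with `r ≤ 2^R`, and the threshold `n = 2¹¹ · (800⁸)^R`
  obtain ⟨R, hR1, hrR⟩ : ∃ R : ℕ, 1 ≤ R ∧ r ≤ 2 ^ R := by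
    refine ⟨max 1 ⌈r⌉₊, le_max_left _ _, (Nat.le_ceil r).trans ?_⟩
    have h1 : (⌈r⌉₊ : ℝ) ≤ (max 1 ⌈r⌉₊ : ℕ) := by exact_mod_cast le_max_right 1 ⌈r⌉₊
    have h2 : ((max 1 ⌈r⌉₊ : ℕ) : ℝ) ≤ 2 ^ (max 1 ⌈r⌉₊) := by
      exact_mod_cast (Nat.lt_two_pow_self).le
    exact h1.trans h2
  set n := 2 ^ 11 * (800 ^ 8) ^ R with hndef
  have hn : 2 ^ 11 * 800 ^ 8 ≤ n := by
    rw [hndef]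
    exact Nat.mul_le_mul_left _ (by
      calc 800 ^ 8 = (800 ^ 8) ^ 1 := (pow_one _).symm
        _ ≤ (800 ^ 8) ^ R := Nat.pow_le_pow_right (by norm_num) hR1)
  have hRn : rOf n = R := rOf_threshold R
  obtain ⟨h1, h2, h3⟩ := sysOf_spec hn
  exact ⟨n, mOf n, sysOf n, h1, h2 r (by rw [hRn]; exact hrR), h3⟩

end FreeCayley

open FreeCayley

/-- **`LinearGeneratorDepthFregeHard` is not vacuous.** For every `n ≥ 2¹¹ · 800⁸` and every
`δ ≥ 199/200` there is a `16`-sparse system `E` over `𝔽₂` on `n` variables whose supports form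
an `(n^(1-δ), 3/4 · 16)`-boundary expander and which is unsolvable — the hypotheses of item
stmt-PneNP-11443 at `ℓ = 16` — and the refuted formula `¬ ofCNF (sumEncoding 1 E)` HAS
depth-`d` `textbookFrege` proofs for every `d ≥ 30` (the item's universally quantified `π`
ranges over a nonempty set). The systems are the Tseitin systems of Margulis's large-girth
Cayley graphs of `SL₂(ℤ/N)`. [cite: Margulis1982, main construction] -/
theorem linearGeneratorDepthFregeHard_hypotheses_nonvacuous :
    ∃ N₀ : ℕ, ∀ n : ℕ, N₀ ≤ n → ∀ δ : ℝ, 199 / 200 ≤ δ →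
      ∃ (m : ℕ) (E : Fin m → LinEqMod 2 n), (∀ i, (E i).supp.card ≤ 16) ∧
        IsBoundaryExpander (fun i => (E i).supp.map Fin.valEmbedding) ((n : ℝ) ^ (1 - δ))
          (3 / 4 * ((16 : ℕ) : ℝ)) ∧
        ¬ SystemSat E Finset.univ ∧
        ∀ d : ℕ, 30 ≤ d → ∃ π : List (PropForm ℕ),
          textbookFrege.IsDepthProofOf d π (PropForm.neg (PropForm.ofCNF (sumEncoding 1 E))) := by
  refine ⟨2 ^ 11 * 800 ^ 8, fun n hn δ hδ => ?_⟩
  obtain ⟨h1, h2, h3⟩ := sysOf_spec hn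
  have hn1 : (1 : ℝ) ≤ n := by
    have : 1 ≤ n := le_trans (by norm_num) hn
    exact_mod_cast this
  have hrad : (n : ℝ) ^ (1 - δ) ≤ 2 ^ rOf n :=
    (Real.rpow_le_rpow_of_exponent_le hn1 (by linarith)).trans (rpow_le_two_pow_rOf hn)
  refine ⟨mOf n, sysOf n, h1, h2 _ hrad, h3, fun d hd => ?_⟩
  refine exists_isDepthProofOf_neg_ofCNF_of_le (fun hsat => h3 ?_) hd
  exact (sumEncoding_satisfiable_iff (p := 2) (B := 1) (by norm_num) (by norm_num) (sysOf n)).1 hsat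

open Summit.PneNP.PneNP.Theses.ExpanderLinearGenerators in
/-- **The item's bound is attained by existing proofs.** If `LinearGeneratorDepthFregeHard`
holds then for every depth `d ≥ 30` and every `δ ∈ [199/200, 1)` there are `ε > 0` and `N`
such that for every `n ≥ N` some `16`-sparse `(n^(1-δ), 12)`-expanding unsolvable system on
`n` variables has a depth-`d` `textbookFrege` refutation, and every such refutation — in
particular that one — has size `≥ 2^(n^ε)`: on this slice the item is an exponential lower
bound about actual bounded-depth Frege proofs of explicit Tseitin formulas (known at column
weight `2` only via Håstad / Galesi–Itsykson–Riazanov–Sofronova-type switching lemmas, none of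
which is in the tree). [cite: KrajicekProofComplexity2019, Problem 19.4.5] -/
theorem linearGeneratorDepthFregeHard_witnessed (h : LinearGeneratorDepthFregeHard) :
    ∀ (d : ℕ) (δ : ℝ), 30 ≤ d → 199 / 200 ≤ δ → δ < 1 →
      ∃ ε : ℝ, 0 < ε ∧ ∃ N : ℕ, ∀ n : ℕ, N ≤ n →
        ∃ (m : ℕ) (E : Fin m → LinEqMod 2 n) (π : List (PropForm ℕ)),
          (∀ i, (E i).supp.card ≤ 16) ∧
          IsBoundaryExpander (fun i => (E i).supp.map Fin.valEmbedding) ((n : ℝ) ^ (1 - δ))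
            (3 / 4 * ((16 : ℕ) : ℝ)) ∧
          ¬ SystemSat E Finset.univ ∧
          textbookFrege.IsDepthProofOf d π (PropForm.neg (PropForm.ofCNF (sumEncoding 1 E))) ∧
          (2 : ℝ) ^ ((n : ℝ) ^ ε) ≤ (proofSize π : ℝ) := by
  intro d δ hd hδ hδ1
  obtain ⟨ε, hε, N, hN⟩ := h 16 d δ (by norm_num) (by linarith) hδ1
  obtain ⟨N₀, hN₀⟩ := linearGeneratorDepthFregeHard_hypotheses_nonvacuous
  refine ⟨ε, hε, max N N₀, fun n hn => ?_⟩
  obtain ⟨m, E, hsp, hexp, hunsat, hprf⟩ := hN₀ n (le_of_max_le_right hn) δ hδ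
  obtain ⟨π, hπ⟩ := hprf d hd
  exact ⟨m, E, π, hsp, hexp, hunsat, hπ, hN n (le_of_max_le_left hn) m E hsp hexp hunsat π hπ⟩

end Summit.PneNP.PneNP.Theorems
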